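import Mathlib.Analysis.SpecialFunctions.Pow.Real
import Mathlib.Analysis.SpecialFunctions.Pow.Deriv
import Mathlib.Analysis.SpecialFunctions.Sqrt
import Mathlib.Analysis.Calculus.IteratedDeriv.Defs
import Mathlib.Analysis.Analytic.Basic
import Literature.Analysis.FunctionSpaces.FlatTorus
import Literature.Analysis.FunctionSpaces.TorusCalculus
import Literature.Analysis.FunctionSpaces.TorusFluidGlue
import Literature.Analysis.FunctionSpaces.TorusFluidGlueProofs
import Literature.Analysis.FunctionSpaces.TorusTrigPoly
import Literature.Analysis.FluidPDE.LerayHopf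
import Literature.Analysis.FluidPDE.NSHopfGalerkin
import Literature.Analysis.FluidPDE.NSHopfGalerkinUnforced
import Literature.Claims.NS.ClayTorusBridge
import HarnessLib

/-!
# Claim skeleton (D-0090 NS-CLAIMS, C129): Nadirashvili, arXiv:2606.02811 v4 (2026) — «Navier–Stokes Equations in Complex Space»

Typed skeleton (ns-claims-typist-7 g3; row C129 NUMBERED T1, FULL grain, lead RULINGS v1.30b
2026-08-27T02:57Z) of N. Nadirashvili, *Navier-Stokes Equations in Complex Space*, arXiv:2606.02811
[math.AP], **v4 (2026-08-19) = TEXT OF RECORD** (45 pp.; PDF page = printed page; bib `Nadirashvili2026`;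
TeX `pub/ns-claims/sources/Nadirashvili2026/v4/src/NS.SN4.tex`, per-page text `v4/pages/pNNN.txt`, renders,
PAGEMAP-v4.md and the §5 diffs v1/v3/v4 by ns-claims-lit-1 g6). Versions: v1 2026-06-01; **v2 2026-06-06
WITHDRAWN by the author («Section 5 needs to be revised»)**; v3 2026-06-21 and v4 2026-08-19 «Section 5
revised». UNREFEREED CLAIM under adjudication — NOTHING in this file asserts a step of the paper: its
statements are `def … : Prop`; the `theorem`s are kernel-checked relations between them (composition,
Clay bookkeeping, two calculus identities about the paper's explicit comparison function). Card
`pub/ns-claims/claims/Nadirashvili2026/CARD.md` (PREDICTION §4 frozen 2026-08-27T03:07Z, sha16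
28344c52ecc3cfc5).

## The claimed statement (v4 p.3, Theorem 1.2; abstract «We prove global in time regularity of solutions of the Navier-Stokes equations defined in the complex space.»)

«Assume that f(x,t) is a solenoidal, uniformly real-analytic vector field defined on M × (0, ∞). Let
w⁰ ∈ L²(M) and div w⁰ = 0 in the sense of distributions. Let w(x,t) be a Leray-Hopf weak solution of
(1.1) – (1.3) on M × [0, ∞). Then for any t > 0, w(x,t) is a real-analytic function on M. If
w⁰ ∈ Lᵖ(M), p > 3, then the weak solution w to (1.1) – (1.3) is unique and the map t → w(·,t) is
continuous as a map from [0, ∞) to Lᵖ(M).» Setting p.2: `M = ℝ³/aℤ³`, `ν > 0`, Leray–Hopf weak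
solutions (Definition p.2, energy inequality c)). Typed: `ClaimedTheorem := ClaimedAnalyticity ∧
ClaimedUniqueness` over the tree's flat unit torus `UnitAddTorus (Fin 3)` (period `a = 1`;
TODO(general form): period `a > 0` — immaterial by the Navier–Stokes scaling, cf.
`ClayVariants.ClayPeriodScalingBridge`), the tree's `Torus.IsGlobalLerayHopf`, and real-analyticity of
an a.e.-representative of the slice (`IsRealAnalytic` = Mathlib `AnalyticOnNhd` of the periodic lift).
The composition target is the UNFORCED specialisation `ClaimedAnalyticity₀` (`f ≡ 0`, the case bearing on
Clay (B); `claimed₀_of_claimed` PROVED); §5 is typed at `f ≡ 0` with the force constant `C ≥ 0` kept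
symbolically in (5.16)–(5.18) exactly where the print carries it.

## Clay delta (CARD §3; reference `Literature.Claims.NS.ClayVariants`, torus axis `ClayTorusBridge`)

Nearest Clay statement (B). Δ1 = (𝕋³; period) · Δ2 = · Δ3 ⊇ (uniformly real-analytic solenoidal f
allowed; (B) has f ≡ 0) · Δ4 ⊇ (w⁰ ∈ L² / Lᵖ, p > 3 ⊇ smooth) · Δ5: the conclusion is a REGULARITY
PROPERTY OF EVERY Leray–Hopf weak solution (STRONGER than (B), registry row «all Leray–Hopf solutions are
smooth»), not the existence of one smooth `(u, p)` with `u(0) = u₀`; the bridge «Leray–Hopf existence on 𝕋³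
(paper's Thm 1.1) + local smooth theory + weak–strong uniqueness ⇒ (B)» is standard but NOT printed —
typed as `ClayDelta` with `clay_of_claimed_of_delta` PROVED (`clayPeriodic_regularityAt_iff_torus`) ·
Δ6 = · Δ7 = (every ν > 0). Not a «wrong problem» candidate.

## Architecture and the typed steps (ORDER OF RECORD = dependency order; v4 PDF pages; TeX lines of NS.SN4.tex in [ ])

§2 complexifies the torus (`Ω_r = M × B_r ⊂ ℂ³`), proves «complex flux energy identities» for solutions
with a holomorphic extension (Thms 2.1/2.2 pp.6–7) and for the (entire) Faedo–Galerkin approximants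
`W^m` (Thms 2.4/2.5 p.10; Prop 2.3 p.8 Galerkin → smooth solution in `L^∞H¹`); §3 functional spaces;
§4 holomorphic solenoidal fields (Lemma 4.3 p.28 the cubic boundary-term bound); §5 «Proof of Theorem
1.2» pp.28–39: by contradiction from an «époque d'irrégularité» `t₁` of the Leray–Hopf solution with
`Lᵖ` datum, `p > 3` (pp.33–34, [GK], [G], [S]; Thm 5.6 p.34 = Leray's rate), through the «nonlinear
differential inequality of the parabolic type for the complex energy» (5.16) p.36 of `E(r,t) =
∫_{Ω_r}|Im W^m|²` and a comparison argument with `y_k(x) = (k/120)x⁵ + x^{41/8}` on `(0, k^{-3/2})`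
(pp.35–38). The complex energy of a band-limited real field is typed CONCRETELY (`holExt`, `imExt`,
`cE`: the entire extension `∑ ĉ_k e^{2πik·(x+iy)}` of a Galerkin mode via its Fourier coefficients;
`d5 a = 32π‖∇a‖²_{L²(𝕋³)}` is `∂⁵E/∂r⁵(0)`, the `r⁵`-Taylor coefficient ×120, since
`|Im W(x+iy)|² = |(y·∇)a(x)|² + O(|y|⁴)` and `∫_{B_r} y_j y_l dy = (4π/15) r⁵ δ_{jl}`).

* Step 1 = `Step_local` — **pp.33–34 [1449–1480]** ([GK], [G], [S]): a Leray–Hopf solution with `Lᵖ`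
  datum, `p > 3`, is classical on some `(0,t₀)` and, if not classical on `(0,∞)`, has an époque
  d'irrégularité `t₁` (maximal interval of classical regularity) — typed as `EpoqueData`.
* Step 2 = `Step_galerkin` — **§2 p.8 (2.8)–(2.9) with (2.6)–(2.7) [296–357] and p.34 [1512–1513]**
  «Denote by W = W^m a solution of Faedo-Galerkin problem with the initial data π_m w⁰»: the unforced
  Faedo–Galerkin approximants exist (tree `IsHopfGalerkinScheme` with `F ≡ 0`) and are energy-bounded by
  the datum (implicit; (2.7) monotonicity of `‖π_m φ‖` and the Galerkin energy identity).
* Step 3 = `Step_LerayRate` — **Theorem 5.6 p.34 [1482–1491]** (Leray): before an époque `t₁`,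
  `‖∇w‖_{L²(M)} ≥ Cν^{3/4}(t₁ − t)^{−1/4}` (typed squared).
* Step 4 = `Step_Prop23` — **Proposition 2.3 p.8 [362–365]**: for a smooth solution on `M × [0,T]` the
  Galerkin approximants converge in `L^∞(0,T; H¹(M))`.
* Step 5 = `Step_choice` — **p.36 [1588–1596]** «For constant K = K(C,b) by Theorem 5.6 and Proposition
  2.3 follows that there are t₂, t₃, 0 < t₂ < t₃ < t₁ and sufficiently large constant m such that for
  Faedo-Galerkin approximations W = W^m … ∂⁵E(0,t₂)/∂r⁵ = K, ∂⁵E(0,t₃)/∂r⁵ = 2K and for t₂ < t < t₃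
  ∂⁵E(0,t)/∂r⁵ > K»: typed as the printed inference `Step_LerayRate ∧ Step_Prop23 → ChoiceBody`, with
  the level read CHARITABLY as «some k ≥ K» (the literal «= K» fails whenever `32π‖∇W^m(t)‖² > K` for all
  `t < t₁`, and the text uses only `k > K`, cf. (5.18)).
* Step 6 = `Step_parce` — **(5.16) p.36 [1559–1572]** with its printed inputs Thms 2.4/2.5 p.10,
  (5.11) p.34, Lemma 5.4 p.30–32, Lemma 4.3 p.28: for every unforced Faedo–Galerkin approximant and all
  `0 < r < 1`, `t > 0`: `E_rr + (4/ν)E_t ≤ (C₀/(νr^{3/2})) E_rr E_r^{1/2} + (4/r)E_r + C r³E_r^{1/2}`,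
  «C₀» absolute (Lemma 4.3 at `a = 1`), «C > 0 depends on p, a, f» (here `f ≡ 0`: some `C ≥ 0`); with the
  implicit regularity «E is C² in (r,t)» (W^m smooth) recorded in the same step.
* Step 7 = `Step_SN1` — **(5.13) p.35 [1539–1544]** «Assume that ∂⁵E(0,t₀)/∂r⁵ ≥ k, then from Lemma
  5.5 and inequality (5.9) follows, that for sufficiently large k E_r(1/k^{3/2}, t₀) > y′_k(1/k^{3/2})»
  — typed at the carrier level (every Galerkin mode; «sufficiently large» allowed to depend on an `L²`
  bound — charitable) and, HYGIENE 13, at the level the printed justification consumes it: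
  `Step_SN1_abs` (every absolutely monotonic `F = E_r(·,t₀)` with the Taylor structure Lemma 5.5 and a
  (5.9)-type coefficient relation provide). Named inputs recorded, not on the path: `Step_mon` (Lemma 5.5
  p.32) and `Step_SN26` ((5.9) p.33 with its displayed interpolation).
* Step 8 = `Step_SN6` — **(5.14) p.35 [1545–1550]**: `∂⁵E(0,t₀)/∂r⁵ = k ⇒ E(x,t₀) < y_k(x)` for
  `0 < x < ε`.
* Step 9 = `Step_SN2` — **(5.15) p.35 [1551–1556]**: `∂⁵E(0,t₀)/∂r⁵ ≥ 2k ⇒ E(x,t₀) > y_k(x)` (no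
  range printed; consumed on `(0, δ)`, `δ = k^{−3/2}`, at p.37 «From inequality (5.15) φ(τ) < 0»; typed on
  `(0, k^{−3/2})` for `k` large).
* Step 10 = `Step_subsol` — **p.36 [1582–1585], display (5.18)**: «From inequality (5.12) follows that for
  any C, b > 0 there is K > 0, K = K(C, b) such that for k > K function y_k(x) is a subsolution of a
  differential inequality on (0, δ), δ = 1/k^{3/2}, y″_k > (b/x^{3/2})(y″_k)(y′_k)^{1/2} + (4/x)y′_k +
  Cx³(y′_k)^{1/2}». Pure real analysis on the explicit `y_k`; kernel-decidable as printed. Input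
  recorded, not on the path: `Step_SN27` ((5.12) p.35).
* Step 11 = `Step_sup` — **pp.36–37 [1607–1645], (5.19)–(5.23)**: the sup-argument for
  `Φ(r,t) = y(r) − E(r,t)`, typed as the calculus statement the page uses (hypotheses = Φ(0,t) = 0,
  (5.19) `E_r(δ,t) > y′(δ)` — the printed (5.20) «Φ′(δ,t) > 0» is read as the sign (5.19) actually gives —,
  (5.14) at `t₂`, (5.15) at `t₃`; conclusion = an interior point `(r₀,T)` with (5.21) `E_r = y′`, (5.22)
  `E_t ≥ 0`, (5.23) `E_rr ≥ y″`; the printed «E(r, t − t₂)», «sup_{0<r<α/2}», «φ(τ) < 0» are read as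
  `E(r, t₂ + t)`, `sup_{0<r<δ}`, `φ(τ) ≤ 0`).
* Step 12 = `Step_glue` — **p.38–39 [1670–1672, 1695–1698] with p.3 [147–148]**: «Therefore w is a
  classical solution … in M × (0, ∞)» ⇒ real-analytic for `t > 0` ([G], [LR], Masuda); `L²` data via
  `H¹ ⊂ L⁶` slices at `tᵢ → 0`: `NoEpoque₀ → ClaimedAnalyticity₀`.
* The closing algebra p.37–38 [1650–1667] («S(r, y″, y′) … is an increasing function of y″ … The last
  inequality and (5.22) contradict (5.17)») is PROVED inside `epoque_false_of_steps` ((5.17) is read with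
  «Assume E_t(r₀,t₀) ≥ 0», which is how (5.22) is used; the print has «E_r»).

REV 2 (additive, §F below; asks of ns-claims-ref-3 g2 RETYPE.md v0.1 and ns-claims-refuter-5 g0 03:34Z): `Step_subsol_deriv`
(+ `deriv_yk`, `deriv_dyk`, `step_subsol_deriv_iff`), `Step_520_printed` ((5.20) as printed), `Step_513_margin` (the
referee's charitable (5.13)′ — TRUE from Lemma 5.5 alone), `Step_sup_margin` (SHAPE of Step 11 under (5.13)′ at the residual
p.37 l.12–19 — kernel-false as typed by junk instances, see its docstring (rev 3 note); `step_sup_of_margin`),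
`Step_L51` (Lemma 5.1 (5.1) p.28 at the functions grain) — all recorded, not on the composition path.

COMPOSITION — PROVED, every numbered step consumed: `claim_of_steps : Step_local → Step_galerkin →
Step_LerayRate → Step_Prop23 → Step_choice → Step_parce → Step_SN1 → Step_SN6 → Step_SN2 → Step_subsol →
Step_sup → Step_glue → ClaimedAnalyticity₀` (through `epoque_false_of_steps : … → EpoqueData … → False` and
`NoEpoque₀`). Recorded, not on the path: `Step_SN27` (5.12), `Step_mon` Lemma 5.5, `Step_SN26` (5.9),
`Step_SN1_abs`, `ClaimedUniqueness` (p.38 «By uniqueness theorem … in L³, [G]»). Clay link: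
`clay_of_claimed_of_delta : ClayDelta → ClaimedTheorem → ClayVariants.clayPeriodic.Regularity` PROVED.

Kernel handles recorded for the refuter/referee (no verdict here): `Step_subsol`, `Step_SN27`,
`Step_SN1_abs` are statements about explicit real functions (`yk`, `dyk`, `ddyk` below; `rpow`);
`Step_SN1`/`Step_SN6`/`Step_SN2`/`Step_mon` quantify over the tree's Galerkin modes `IsGalerkinMode N a`
(band-limited real divergence-free trigonometric polynomials — a single shear mode
`a(x) = (A sin 2πx₃, 0, 0)` is one, with `imExt` = `(A cos 2πx₃ · sinh 2πy₃, 0, 0)` up to sign and `cE`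
explicit); `Step_parce`/`Step_choice`/`Step_Prop23` quantify over `IsHopfGalerkinScheme ν 0 u₀ N F W` with
`F ≡ 0`. VERSION NOTE (chair's HYGIENE ask): the v3 endgame used `y = x^{9/2}` against a (5.16) with
`(3/r)E_r + Cr²E_r^{1/2}`; v4's (5.16) has `(4/r)E_r + Cr³E_r^{1/2}`, whose power solution is `r⁵`, whence
the `k`-dependent family `y_k` and the window `(0, k^{−3/2})` — the typed Steps 7–11 exist only in v4.

WHAT THIS IS NOT: not a claim about NS regularity or blow-up; not a claim about any author beyond the
typed locator.
-/

open scoped ContDiff ENNReal InnerProductSpace RealInnerProductSpace Topology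
open _root_.MeasureTheory _root_.Set Function

namespace Literature.Claims.NS.Nadirashvili2026

open Literature.Analysis.FunctionSpaces Literature.Analysis.FluidPDE

noncomputable section

/-! ## A. Vocabulary (definitions with bodies; nothing asserted) -/

/-- The flat unit 3-torus (the paper's `M = ℝ³/aℤ³` at `a = 1`). [cite: Nadirashvili2026, §1 p.2] -/
abbrev T3 : Type := UnitAddTorus (Fin 3)

/-- Real 3-space (values of the velocity; the imaginary directions `y ∈ Y`). [cite: Nadirashvili2026, §2 p.3–4] -/
abbrev E3 : Type := EuclideanSpace ℝ (Fin 3)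

/-- Complex 3-space `ℂ³ ⊃ Ω_r = M × B_r`. [cite: Nadirashvili2026, §2 p.3–4] -/
abbrev C3 : Type := EuclideanSpace ℂ (Fin 3)

/-- «w(x,t) is a real-analytic function on M» (Thm 1.2 p.3): the periodic lift to `ℝ³` is real-analytic
everywhere (Mathlib `AnalyticOnNhd`). [cite: Nadirashvili2026, Theorem 1.2 p.3] -/
def IsRealAnalytic (v : T3 → E3) : Prop :=
  AnalyticOnNhd ℝ (Torus.lift v) Set.univ

/-- The admissible forces of Thm 1.2 (p.3 [147–150]): `f` solenoidal for every `t > 0` and «uniformly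
real-analytic»: «for any T > 0, r(t) > c(T) > 0 on (0,T) and f(z,t) has a uniformly bounded holomorphic
extension in a slab |Im z| < c(T) in ℂ³, for all t ∈ (0,T)». [cite: Nadirashvili2026, §1 p.3] -/
structure IsAdmissibleForce (f : ℝ → T3 → E3) : Prop where
  smooth : ∀ t, 0 < t → Torus.IsSmooth (f t)
  divFree : ∀ t, 0 < t → Torus.IsDivFree (f t)
  analytic : ∃ F : ℝ → C3 → C3, ∀ T, 0 < T → ∃ c B : ℝ, 0 < c ∧
    ∀ t ∈ Ioo 0 T,
      DifferentiableOn ℂ (F t) {z | ∀ j, |(z j).im| < c} ∧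
        (∀ z : C3, (∀ j, |(z j).im| < c) → ‖F t z‖ ≤ B) ∧
          ∀ x : E3, F t (EuclideanSpace.complexify x) = EuclideanSpace.complexify (Torus.lift (f t) x)

/-- The entire extension of a Galerkin mode of order `N` (a band-limited real field on `𝕋³`, Fourier
support `|k|² ≤ N²`): `W(x + iy) = ∑_k ĉ_k e^{2πi k·(x+iy)} = ∑_k e^{2πik·x} e^{−2πk·y} ĉ_k`
(§2 p.7–8: «Since vᵢ are trigonometric polynomials they have holomorphic extensions to ℂ³»).
[cite: Nadirashvili2026, §2 p.7–8] -/
def holExt (N : ℕ) (a : T3 → E3) (x : T3) (y : E3) : C3 :=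
  ∑ k ∈ Torus.freqBall N,
    ((UnitAddTorus.mFourier k x : ℂ) *
        ((Real.exp (-(2 * Real.pi * ∑ j, (k j : ℝ) * y j)) : ℝ) : ℂ)) •
      UnitAddTorus.mFourierCoeff (EuclideanSpace.complexify ∘ a) k

/-- `V = Im W`, the imaginary part of the entire extension at `z = x + iy` (§2 p.4 «u = Re w, v = Im w»;
§5 p.34 `W = U + iV = W^m`). [cite: Nadirashvili2026, §5 p.34] -/
def imExt (N : ℕ) (a : T3 → E3) (x : T3) (y : E3) : E3 :=
  WithLp.toLp 2 fun j => (holExt N a x y j).im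

/-- The **complex energy** `E(r) = ∫_{Ω_r} |V|² dx dy`, `Ω_r = M × B_r` (p.34 [1515]); for the Galerkin
approximant `W^m(·,t)` of order `N`, `E(r,t) = cE N (W^m t) r`. (`E_r = e = ∫_{∂Ω_r}|V|² dσ`,
`E_rr − 2E_r/r = 2∫_{∂Ω_r}(V, ∂V/∂n) dσ`, (5.11) p.34.) [cite: Nadirashvili2026, §5 p.34 (5.11)] -/
def cE (N : ℕ) (a : T3 → E3) (r : ℝ) : ℝ :=
  ∫ x : T3, ∫ y in Metric.ball (0 : E3) r, ‖imExt N a x y‖ ^ 2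

/-- `∂⁵E/∂r⁵(0)` for the complex energy of a band-limited real field `a`: `E(r) = (4π/15)‖∇a‖²_{L²} r⁵ +
O(r⁷)` (from `Im W(x+iy) = ±(y·∇)a(x) + O(|y|³)` and `∫_{B_r} y_j y_l dy = (4π/15) r⁵ δ_{jl}`), so
`∂⁵E/∂r⁵(0) = 120 · (4π/15)‖∇a‖² = 32π‖∇a‖²_{L²(𝕋³)}` (tree `Torus.gradNormSq`). This is the quantity the
choice sentence p.36 controls through Thm 5.6 + Prop 2.3 (the enstrophy). [cite: Nadirashvili2026, §5 p.35–36] -/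
def d5 (a : T3 → E3) : ℝ :=
  32 * Real.pi * Torus.gradNormSq a

/-- The comparison family **(p.35 [1531])** `y_k(x) = (k/120) x⁵ + x^{41/8}`. [cite: Nadirashvili2026, §5 p.35] -/
def yk (k x : ℝ) : ℝ :=
  k / 120 * x ^ 5 + x ^ (41 / 8 : ℝ)

/-- `y′_k(x) = (k/24) x⁴ + (41/8) x^{33/8}`. [cite: Nadirashvili2026, §5 p.35] -/
def dyk (k x : ℝ) : ℝ :=
  k / 24 * x ^ 4 + 41 / 8 * x ^ (33 / 8 : ℝ)

/-- `y″_k(x) = (k/6) x³ + (41/8)(33/8) x^{25/8}`. [cite: Nadirashvili2026, §5 p.35] -/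
def ddyk (k x : ℝ) : ℝ :=
  k / 6 * x ^ 3 + 41 / 8 * (33 / 8) * x ^ (25 / 8 : ℝ)

/-- `‖u‖²_{L²(M)}`. [cite: Nadirashvili2026, §3 p.13] -/
def l2NormSq (u : T3 → E3) : ℝ :=
  ∫ x, ‖u x‖ ^ 2

/-- Third partial derivative `∂³u/∂x_j³` on `𝕋³` ((5.8)–(5.9) p.32–33). [cite: Nadirashvili2026, §5 (5.9) p.33] -/
def d3 (j : Fin 3) (u : T3 → E3) (x : T3) : E3 :=
  Torus.partialDeriv j (Torus.partialDeriv j (Torus.partialDeriv j u)) x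

/-! ## B. The claimed statement, its unforced specialisation, and the internal target of §5 -/

/-- **Theorem 1.2, first sentence (p.3)**: for every `ν > 0`, every admissible force, every `L²`
weakly divergence-free datum and EVERY Leray–Hopf weak solution `w` on `M × [0,∞)`, for every `t > 0`
the slice `w(·,t)` is (a.e. equal to) a real-analytic function on `M`. [claim: Nadirashvili2026, status: disputed] -/
def ClaimedAnalyticity : Prop :=
  ∀ ν : ℝ, 0 < ν → ∀ f : ℝ → T3 → E3, IsAdmissibleForce f →
    ∀ u₀ : T3 → E3, MemLp u₀ 2 volume → Torus.IsWeaklyDivFree u₀ →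
      ∀ u : ℝ → T3 → E3, Torus.IsGlobalLerayHopf ν f u₀ u →
        ∀ t, 0 < t → ∃ v : T3 → E3, IsRealAnalytic v ∧ v =ᵐ[volume] u t

/-- **Theorem 1.2, second sentence (p.3)**: «If w⁰ ∈ Lᵖ(M), p > 3, then the weak solution w … is
unique and the map t → w(·,t) is continuous as a map from [0, ∞) to Lᵖ(M)» (uniqueness within the
Leray–Hopf class, slices compared a.e.). Recorded; not on the composition path (p.38 «By uniqueness
theorem … in L³, [G]»). [claim: Nadirashvili2026, status: disputed] -/
def ClaimedUniqueness : Prop :=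
  ∀ ν : ℝ, 0 < ν → ∀ f : ℝ → T3 → E3, IsAdmissibleForce f →
    ∀ p : ℝ≥0∞, (3 : ℝ≥0∞) < p → ∀ u₀ : T3 → E3, MemLp u₀ p volume → Torus.IsWeaklyDivFree u₀ →
      ∀ u v : ℝ → T3 → E3, Torus.IsGlobalLerayHopf ν f u₀ u → Torus.IsGlobalLerayHopf ν f u₀ v →
        (∀ t, 0 ≤ t → u t =ᵐ[volume] v t) ∧ Torus.ContinuousInLpOn (Ici 0) p u

/-- **The claimed statement, Theorem 1.2 p.3** (both sentences). [claim: Nadirashvili2026, status: disputed] -/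
def ClaimedTheorem : Prop :=
  ClaimedAnalyticity ∧ ClaimedUniqueness

/-- **Theorem 1.2 at `f ≡ 0`** (the specialisation bearing on Clay (B); composition target).
[claim: Nadirashvili2026, status: disputed] -/
def ClaimedAnalyticity₀ : Prop :=
  ∀ ν : ℝ, 0 < ν → ∀ u₀ : T3 → E3, MemLp u₀ 2 volume → Torus.IsWeaklyDivFree u₀ →
    ∀ u : ℝ → T3 → E3, Torus.IsGlobalLerayHopf ν 0 u₀ u →
      ∀ t, 0 < t → ∃ v : T3 → E3, IsRealAnalytic v ∧ v =ᵐ[volume] u t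

/-- **The statement the §5 contradiction argument establishes (p.34 [1503–1504], p.38 [1670]
«Therefore w is a classical solution of the Navier-Stokes equations in M × (0, ∞)»)**, at `f ≡ 0`: every
Leray–Hopf weak solution with weakly divergence-free datum in `Lᵖ`, `p > 3`, agrees on `(0,∞)` with a
classical solution. [claim: Nadirashvili2026, status: disputed] -/
def NoEpoque₀ : Prop :=
  ∀ (ν : ℝ) (p : ℝ≥0∞) (u₀ : T3 → E3) (u : ℝ → T3 → E3), 0 < ν → (3 : ℝ≥0∞) < p →
    MemLp u₀ p volume → Torus.IsWeaklyDivFree u₀ → Torus.IsGlobalLerayHopf ν 0 u₀ u →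
      ∃ (U : ℝ → T3 → E3) (P : ℝ → T3 → ℝ),
        Torus.IsClassicalNSSolutionOn (Ioi 0) ν 0 U P ∧ ∀ t ∈ Ioi 0, U t =ᵐ[volume] u t

/-- **An «époque d'irrégularité» (pp.33–34 [1477–1480]; Leray)**: `u` is an unforced Leray–Hopf solution
from an `Lᵖ` datum (`p > 3`), classical (through the representative `U, P`) exactly on `(0, t₁)`,
`0 < t₁ < ∞` — «a maximal interval (0,t₁) for which w is a classical solution».
[cite: Nadirashvili2026, §5 p.34] -/
structure EpoqueData (ν : ℝ) (p : ℝ≥0∞) (u₀ : T3 → E3) (u : ℝ → T3 → E3) (t₁ : ℝ)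
    (U : ℝ → T3 → E3) (P : ℝ → T3 → ℝ) : Prop where
  visc : 0 < ν
  exponent : (3 : ℝ≥0∞) < p
  datum : MemLp u₀ p volume
  divFree : Torus.IsWeaklyDivFree u₀
  lerayHopf : Torus.IsGlobalLerayHopf ν 0 u₀ u
  pos : 0 < t₁
  classical : Torus.IsClassicalNSSolutionOn (Ioo 0 t₁) ν 0 U P
  agrees : ∀ t ∈ Ioo 0 t₁, U t =ᵐ[volume] u t
  maximal : ∀ t', t₁ < t' → ¬ ∃ (U' : ℝ → T3 → E3) (P' : ℝ → T3 → ℝ),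
    Torus.IsClassicalNSSolutionOn (Ioo 0 t') ν 0 U' P' ∧ ∀ t ∈ Ioo 0 t', U' t =ᵐ[volume] u t

/-! ## C. The steps -/

/-- **Step 1 — pp.33–34 [1449–1480]** «From [GK], [S], [G] follows the existence of t₀ > 0 such that w is
a classical solution on M × (0,t₀). If w is not a classical solution on M × (0,∞) then there is a maximal
interval (0,t₁), t₀ < t₁ < ∞, for which w is a classical solution» (typed at `f ≡ 0`).
[claim: Nadirashvili2026, status: disputed] -/
def Step_local : Prop :=
  ∀ (ν : ℝ) (p : ℝ≥0∞) (u₀ : T3 → E3) (u : ℝ → T3 → E3), 0 < ν → (3 : ℝ≥0∞) < p →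
    MemLp u₀ p volume → Torus.IsWeaklyDivFree u₀ → Torus.IsGlobalLerayHopf ν 0 u₀ u →
      (¬ ∃ (U : ℝ → T3 → E3) (P : ℝ → T3 → ℝ),
          Torus.IsClassicalNSSolutionOn (Ioi 0) ν 0 U P ∧ ∀ t ∈ Ioi 0, U t =ᵐ[volume] u t) →
        ∃ (t₁ : ℝ) (U : ℝ → T3 → E3) (P : ℝ → T3 → ℝ), EpoqueData ν p u₀ u t₁ U P

/-- **Step 2 — §2 p.8 (2.8)–(2.9) [345–357] with (2.6)–(2.7) [327–333], used p.34 [1512–1513]** «Denote by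
W = W^m a solution of Faedo-Galerkin problem with the initial data π_m w⁰»: in an époque scenario the
unforced Faedo–Galerkin approximants exist (tree `IsHopfGalerkinScheme`, `F ≡ 0`) and every slice is
energy-bounded by the datum (`‖π_m φ‖ ≤ ‖φ‖`, Galerkin energy identity). Implicit/standard.
[claim: Nadirashvili2026, status: disputed] -/
def Step_galerkin : Prop :=
  ∀ (ν : ℝ) (p : ℝ≥0∞) (u₀ : T3 → E3) (u : ℝ → T3 → E3) (t₁ : ℝ) (U : ℝ → T3 → E3) (P : ℝ → T3 → ℝ),
    EpoqueData ν p u₀ u t₁ U P →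
      ∃ (N : ℕ → ℕ) (F W : ℕ → ℝ → T3 → E3), IsHopfGalerkinScheme ν 0 u₀ N F W ∧ (∀ n, F n = 0) ∧
        ∀ n t, 0 ≤ t → Torus.kineticEnergy (W n t) ≤ Torus.kineticEnergy u₀

/-- **Step 3 — Theorem 5.6 p.34 [1482–1487]** (Leray [Le], see [S], [G]): «Let 0 < t₁ < ∞ be an
"époque de irrégularite" for w. Then ‖∇w‖_{L²(M)} ≥ Cν^{3/4}/(t₁−t)^{1/4} for t < t₁» (C absolute; typed
squared, along the classical representative). [claim: Nadirashvili2026, status: disputed] -/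
def Step_LerayRate : Prop :=
  ∃ C : ℝ, 0 < C ∧
    ∀ (ν : ℝ) (p : ℝ≥0∞) (u₀ : T3 → E3) (u : ℝ → T3 → E3) (t₁ : ℝ) (U : ℝ → T3 → E3)
      (P : ℝ → T3 → ℝ), EpoqueData ν p u₀ u t₁ U P →
        ∀ t ∈ Ioo 0 t₁, C * ν ^ (3 / 2 : ℝ) / Real.sqrt (t₁ - t) ≤ Torus.gradNormSq (U t)

/-- **Step 4 — Proposition 2.3 p.8 [362–365]**: «Assume w⁰, f are smooth and w is a smooth solution of
the Navier-Stokes equations (1.1)–(1.3) in M × [0,T]. Let w^m be a solution of (2.8), (2.9),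
w^m(x,0) = w(x,0). Then w^m → w in L^∞H¹(M) as m → ∞» (typed at `f ≡ 0` over the tree's Hopf–Galerkin
scheme from the datum `w 0`; sup-in-time as an `ε`–`n₀` statement, no `sSup`).
[claim: Nadirashvili2026, status: disputed] -/
def Step_Prop23 : Prop :=
  ∀ (ν T : ℝ) (w : ℝ → T3 → E3) (q : ℝ → T3 → ℝ), 0 < ν → 0 < T →
    Torus.IsClassicalNSSolutionOn (Icc 0 T) ν 0 w q →
      ∀ (N : ℕ → ℕ) (F W : ℕ → ℝ → T3 → E3), IsHopfGalerkinScheme ν 0 (w 0) N F W → (∀ n, F n = 0) →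
        ∀ ε, 0 < ε → ∃ n₀ : ℕ, ∀ n, n₀ ≤ n → ∀ t ∈ Icc 0 T,
          Torus.gradNormSq (W n t - w t) + ∫ x, ‖W n t x - w t x‖ ^ 2 < ε

/-- The conclusion of the choice sentence p.36 [1588–1596] (charitable level `k ≥ K`): in an époque
scenario, for every unforced Faedo–Galerkin family and every `K > 0` there are `k ≥ K`, an index `n`
(«sufficiently large m») and times `0 < t₂ < t₃ < t₁` with `∂⁵E(0,t₂)/∂r⁵ = k`, `∂⁵E(0,t₃)/∂r⁵ = 2k`
and `∂⁵E(0,t)/∂r⁵ > k` on `(t₂,t₃)` (`∂⁵E/∂r⁵(0,t) = d5 (W n t)`). [claim: Nadirashvili2026, status: disputed] -/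
def ChoiceBody : Prop :=
  ∀ (ν : ℝ) (p : ℝ≥0∞) (u₀ : T3 → E3) (u : ℝ → T3 → E3) (t₁ : ℝ) (U : ℝ → T3 → E3) (P : ℝ → T3 → ℝ),
    EpoqueData ν p u₀ u t₁ U P →
      ∀ (N : ℕ → ℕ) (F W : ℕ → ℝ → T3 → E3), IsHopfGalerkinScheme ν 0 u₀ N F W → (∀ n, F n = 0) →
        ∀ K : ℝ, 0 < K → ∃ k : ℝ, K ≤ k ∧ ∃ (n : ℕ) (t₂ t₃ : ℝ), 0 < t₂ ∧ t₂ < t₃ ∧ t₃ < t₁ ∧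
          d5 (W n t₂) = k ∧ d5 (W n t₃) = 2 * k ∧ ∀ t ∈ Ioo t₂ t₃, k < d5 (W n t)

/-- **Step 5 — p.36 [1588–1596]** «For constant K = K(C,b) by Theorem 5.6 and Proposition 2.3 follows
that there are t₂, t₃ … and sufficiently large constant m such that …»: the printed inference from
Steps 3 and 4 to `ChoiceBody`. [claim: Nadirashvili2026, status: disputed] -/
def Step_choice : Prop :=
  Step_LerayRate ∧ Step_Prop23 → ChoiceBody

/-- **Step 6 — (5.16) p.36 [1559–1572]** «the nonlinear differential inequality of the parabolic type for
the complex energy» `E_rr + (4/ν)E_t ≤ (C₀/(νr^{3/2})) E_rr E_r^{1/2} + (4/r)E_r + Cr³E_r^{1/2}`,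
`0 < r < 1`, for the complex energy `E(r,t) = cE (N n) (W n t) r` of EVERY unforced Faedo–Galerkin
approximant (inputs as printed: Thms 2.4−2.5 p.10, (5.11) p.34, Lemma 5.4 p.30, Lemma 4.3 p.28; «C₀»
absolute, «C > 0 depends on p, a, f» — at `f ≡ 0` some `C ≥ 0`), together with the implicit regularity
«E is C² on (0,1) × (0,∞), continuous up to r = 0, t = 0» (W^m smooth). `E_r`, `E_rr`, `E_t` are the
classical derivatives `deriv`/`iteratedDeriv 2`. [claim: Nadirashvili2026, status: disputed] -/
def Step_parce : Prop :=
  ∃ C₀ : ℝ, 0 < C₀ ∧ ∀ ν : ℝ, 0 < ν → ∃ C : ℝ, 0 ≤ C ∧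
    ∀ (u₀ : T3 → E3) (N : ℕ → ℕ) (F W : ℕ → ℝ → T3 → E3),
      IsHopfGalerkinScheme ν 0 u₀ N F W → (∀ n, F n = 0) → ∀ n : ℕ,
        (ContinuousOn (Function.uncurry fun r t => cE (N n) (W n t) r) (Icc 0 1 ×ˢ Ici 0) ∧
          ContDiffOn ℝ 2 (Function.uncurry fun r t => cE (N n) (W n t) r) (Ioo 0 1 ×ˢ Ioi 0)) ∧
        ∀ r ∈ Ioo (0 : ℝ) 1, ∀ t ∈ Ioi (0 : ℝ),
          iteratedDeriv 2 (cE (N n) (W n t)) r + 4 / ν * deriv (fun s => cE (N n) (W n s) r) t ≤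
            C₀ / (ν * r ^ (3 / 2 : ℝ)) * iteratedDeriv 2 (cE (N n) (W n t)) r *
                Real.sqrt (deriv (cE (N n) (W n t)) r) +
              4 / r * deriv (cE (N n) (W n t)) r +
              C * r ^ 3 * Real.sqrt (deriv (cE (N n) (W n t)) r)

/-- **Step 7 — (5.13) p.35 [1539–1544]** «Assume that ∂⁵E(0,t₀)/∂r⁵ ≥ k, then from Lemma 5.5 and
inequality (5.9) follows, that for sufficiently large k E_r(1/k^{3/2}, t₀) > y′_k(1/k^{3/2})» — for the
complex energy of every Galerkin mode (the class Lemma 5.5 and (5.9) address), «sufficiently large»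
allowed to depend on an `L²`-energy bound `B` of the field (charitable; p.34 [1508–1510] fixes
`‖w(·,t)‖_{L²} ≤ N`). [claim: Nadirashvili2026, status: disputed] -/
def Step_SN1 : Prop :=
  ∀ B : ℝ, 0 ≤ B → ∃ k₀ : ℝ, ∀ k : ℝ, k₀ ≤ k →
    ∀ (N : ℕ) (a : T3 → E3), IsGalerkinMode N a → Torus.kineticEnergy a ≤ B → k ≤ d5 a →
      dyk k (k ^ (-(3 / 2 : ℝ))) < deriv (cE N a) (k ^ (-(3 / 2 : ℝ)))

/-- **Step 7, abstract grain (HYGIENE 13)** — (5.13) at the level its printed justification consumes it: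
for `F = E_r(·,t₀)` the inputs named on p.35 are Lemma 5.5 p.32 («F^{(n)}(r) ≥ 0», absolute
monotonicity on `[0,1)`), the expansion `F(r) = (k′/24)r⁴ + a₆r⁶ + a₈r⁸ + …` with `k′ = ∂⁵E(0,t₀)/∂r⁵
≥ k` (p.33–35), and (5.9) p.33 / interpolation, which bound the higher Taylor coefficients BELOW by
powers of `k′` over an `L²` bound `B` (`a₆ ≳ k′²/B`, `a₈ ≳ k′³/B²`, constants `c₆, c₈ > 0` arbitrary).
Claimed conclusion: `F(k^{−3/2}) > y′_k(k^{−3/2})` for `k` large. [claim: Nadirashvili2026, status: disputed] -/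
def Step_SN1_abs : Prop :=
  ∀ c₆ c₈ B : ℝ, 0 < c₆ → 0 < c₈ → 0 < B → ∃ k₀ : ℝ, ∀ k : ℝ, k₀ ≤ k →
    ∀ F : ℝ → ℝ, ContDiff ℝ ∞ F → (∀ n : ℕ, ∀ x ∈ Ico (0 : ℝ) 1, 0 ≤ iteratedDeriv n F x) →
      F 0 = 0 → deriv F 0 = 0 → iteratedDeriv 2 F 0 = 0 → iteratedDeriv 3 F 0 = 0 →
        k ≤ iteratedDeriv 4 F 0 →
          c₆ * (iteratedDeriv 4 F 0) ^ 2 / B ≤ iteratedDeriv 6 F 0 →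
            c₈ * (iteratedDeriv 4 F 0) ^ 3 / B ^ 2 ≤ iteratedDeriv 8 F 0 →
              dyk k (k ^ (-(3 / 2 : ℝ))) < F (k ^ (-(3 / 2 : ℝ)))

/-- **Named input of Step 7, recorded — Lemma 5.5 p.32 [1418–1423]** «Let H be a pluriharmonic function
in Ω_r, r < 1, vanishing on the real subspace. Let F(r) = ∫_{∂Ω_r} H² dσ. Then F^{(n)}(r) ≥ 0», at the
instances §5 uses (`H` = components of `Im W^m`, `F = E_r`): every `r`-derivative of `E_r` of the complex
energy of a Galerkin mode is non-negative on `(0,1)`. Not on the composition path.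
[claim: Nadirashvili2026, status: disputed] -/
def Step_mon : Prop :=
  ∀ (N : ℕ) (a : T3 → E3), IsGalerkinMode N a →
    ∀ n : ℕ, ∀ r ∈ Ioo (0 : ℝ) 1, 0 ≤ iteratedDeriv (n + 1) (cE N a) r

/-- **Named input of Step 7, recorded — the interpolation displayed before (5.9), p.33 [1435–1443]**
«‖u(·,0)‖³_{H¹(M)} ≤ C‖u(·,0)‖²_{L²(M)} (∑_j ‖∂³u(x,0)/∂x_j³‖_{L²(M)})» for smooth fields on `M`, with the
paper's INHOMOGENEOUS norm `‖u‖²_{H¹} = |u|²_{Ḣ¹} + ‖u‖²_{L²}` (§3 p.13 [581–586]) — as printed it fails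
on constant fields; the homogeneous reading is the classical interpolation `Ḣ¹ ⊂ [L², Ḣ³]`. Not on the
composition path. [claim: Nadirashvili2026, status: disputed] -/
def Step_SN26 : Prop :=
  ∃ C : ℝ, 0 < C ∧ ∀ u : T3 → E3, Torus.IsSmooth u →
    Real.sqrt (l2NormSq u + Torus.gradNormSq u) ^ 3 ≤
      C * l2NormSq u * ∑ j : Fin 3, Real.sqrt (∫ x, ‖d3 j u x‖ ^ 2)

/-- **Step 8 — (5.14) p.35 [1545–1550]** «Assume that ∂⁵E(0,t₀)/∂r⁵ = k. Then there is an ε > 0 such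
that for 0 < x < ε … E(x,t₀) < y_k(x)», for the complex energy of every Galerkin mode.
[claim: Nadirashvili2026, status: disputed] -/
def Step_SN6 : Prop :=
  ∀ (N : ℕ) (a : T3 → E3) (k : ℝ), IsGalerkinMode N a → 0 < k → d5 a = k →
    ∃ ε : ℝ, 0 < ε ∧ ∀ x ∈ Ioo 0 ε, cE N a x < yk k x

/-- **Step 9 — (5.15) p.35 [1551–1556]** «the inequality ∂⁵E(0,t₀)/∂r⁵ ≥ 2k implies E(x,t₀) > y_k(x)»
(no range printed; consumed on `(0, δ)`, `δ = k^{−3/2}`, for `k` large, at p.37 «From inequality (5.15)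
φ(τ) < 0»). [claim: Nadirashvili2026, status: disputed] -/
def Step_SN2 : Prop :=
  ∃ k₀ : ℝ, ∀ k : ℝ, k₀ ≤ k → ∀ (N : ℕ) (a : T3 → E3), IsGalerkinMode N a → 2 * k ≤ d5 a →
    ∀ x ∈ Ioo 0 (k ^ (-(3 / 2 : ℝ))), yk k x < cE N a x

/-- **Named input of Step 10, recorded — (5.12) p.35 [1535–1537]** «For sufficiently large k and
x ∈ (0, 1/k^{3/2}) the following inequality holds x^{−3/2} √(y′_k(x)) < x^{1/6}». Not on the composition
path. [claim: Nadirashvili2026, status: disputed] -/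
def Step_SN27 : Prop :=
  ∃ k₀ : ℝ, ∀ k : ℝ, k₀ ≤ k → ∀ x ∈ Ioo 0 (k ^ (-(3 / 2 : ℝ))),
    x ^ (-(3 / 2 : ℝ)) * Real.sqrt (dyk k x) < x ^ (1 / 6 : ℝ)

/-- **Step 10 — p.36 [1582–1585], display (5.18)** «From inequality (5.12) follows that for any C, b > 0
there is K > 0, K = K(C,b) such that for k > K function y_k(x) is a subsolution of a differential
inequality on (0,δ), δ = 1/k^{3/2}: y″_k > (b/x^{3/2})(y″_k)(y′_k)^{1/2} + (4/x) y′_k + C x³ (y′_k)^{1/2}».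
[claim: Nadirashvili2026, status: disputed] -/
def Step_subsol : Prop :=
  ∀ C b : ℝ, 0 < C → 0 < b → ∃ K : ℝ, 0 < K ∧ ∀ k : ℝ, K < k →
    ∀ x ∈ Ioo 0 (k ^ (-(3 / 2 : ℝ))),
      b / x ^ (3 / 2 : ℝ) * ddyk k x * Real.sqrt (dyk k x) + 4 / x * dyk k x +
          C * x ^ 3 * Real.sqrt (dyk k x) < ddyk k x

/-- **Step 11 — the sup-argument pp.36–37 [1607–1645], (5.19)–(5.23)**, as the calculus statement the page
uses: `Φ(r,t) = y(r) − E(r,t)` on `[0,δ] × [t₂,t₃]` with `Φ(0,t) = 0`, (5.19) `E_r(δ,t) > y′(δ)` (the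
boundary sign; printed (5.20) «Φ′(δ,t) > 0» read as what (5.19) gives), `φ(t₂) > 0` from (5.14) and
`Φ(·,t₃) < 0` on `(0,δ)` from (5.15) «Hence there exists T … φ′(T) < 0. Let 0 ≤ r₀ ≤ δ be such that
Φ(r₀,T) = φ(T) … 0 < r₀ < δ. Therefore E_r(r₀,T) = y′(r₀) (5.21), E_t(r₀,T) ≥ 0 (5.22) and …
E_rr(r₀,T) ≥ y″(r₀) (5.23)». (`y`, `y′`, `y″` abstract with the derivative relations as hypotheses;
`E` continuous on the closed rectangle and C² on an open neighbourhood of `(0,δ] × [t₂,t₃]`.)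
[claim: Nadirashvili2026, status: disputed] -/
def Step_sup : Prop :=
  ∀ (δ t₂ t₃ : ℝ) (y y' y'' : ℝ → ℝ) (E : ℝ → ℝ → ℝ), 0 < δ → t₂ < t₃ → y 0 = 0 →
    (∀ x ∈ Icc 0 δ, HasDerivAt y (y' x) x) → (∀ x ∈ Icc 0 δ, HasDerivAt y' (y'' x) x) →
      ContinuousOn (Function.uncurry E) (Icc 0 δ ×ˢ Icc t₂ t₃) →
        (∃ O : Set (ℝ × ℝ), IsOpen O ∧ Ioc 0 δ ×ˢ Icc t₂ t₃ ⊆ O ∧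
            ContDiffOn ℝ 2 (Function.uncurry E) O) →
          (∀ t ∈ Icc t₂ t₃, E 0 t = 0) →
            (∀ t ∈ Icc t₂ t₃, y' δ < deriv (fun r => E r t) δ) →
              (∃ x ∈ Ioo 0 δ, E x t₂ < y x) →
                (∀ x ∈ Ioo 0 δ, y x < E x t₃) →
                  ∃ T ∈ Ioo t₂ t₃, ∃ r₀ ∈ Ioo 0 δ,
                    deriv (fun r => E r T) r₀ = y' r₀ ∧
                      y'' r₀ ≤ iteratedDeriv 2 (fun r => E r T) r₀ ∧
                        0 ≤ deriv (fun t => E r₀ t) T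

/-- **Step 12 — p.38–39 [1670–1672, 1695–1698] with p.3 [147–148]** «Therefore w is a classical solution
of the Navier-Stokes equations in M × (0, ∞)» ⇒ (classical solutions are real-analytic: [G], [LR],
Masuda [Ma]) Theorem 1.2's analyticity for `Lᵖ` data; «Assume now that w(x,t) is a weak Leray-Hopf
solution … with the initial data w⁰ in L² … there is a sequence tᵢ > 0, tᵢ → 0 … such that
w(·,tᵢ) ∈ H¹(M) ⊂ L⁶(M). Then from proved above regularity … for p > 3 it follows that … w is a
classical solution on M × (tᵢ, ∞) and Theorem 1.2 follows» (at `f ≡ 0`).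
[claim: Nadirashvili2026, status: disputed] -/
def Step_glue : Prop :=
  NoEpoque₀ → ClaimedAnalyticity₀

/-! ## D. Clay bookkeeping (Δ5): the unprinted standard bridge to (B) -/

/-- **Clay delta (Δ5/Δ6, CARD §3)** — the exact bridge, standard but not printed, under which Theorem 1.2
at `f ≡ 0` yields Clay (B) in torus form: for a smooth divergence-free datum on `𝕋³`, «every Leray–Hopf
solution from it is real-analytic for all `t > 0`» implies the existence of a global classical solution
`(U, P)` attaining the datum (Leray–Hopf existence, the paper's Thm 1.1 p.2–3, plus local smooth
well-posedness and weak–strong uniqueness; tree: `hopf_galerkin_scheme_exists`/`hopf_galerkin_limit`,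
`Torus.IsWeakNSSolutionWithDataOn`-level weak–strong facts). [cite: FeffermanClay2006, (B) p. 2] -/
def ClayDelta : Prop :=
  ∀ ν : ℝ, 0 < ν → ∀ U₀ : T3 → E3, Torus.IsSmooth U₀ → Torus.IsDivFree U₀ →
    (∀ u : ℝ → T3 → E3, Torus.IsGlobalLerayHopf ν 0 U₀ u →
        ∀ t, 0 < t → ∃ v : T3 → E3, IsRealAnalytic v ∧ v =ᵐ[volume] u t) →
      ∃ (U : ℝ → T3 → E3) (P : ℝ → T3 → ℝ), Torus.IsClassicalNSSolutionOn (Ici 0) ν 0 U P ∧ U 0 = U₀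

/-! ## E. Kernel-checked relations (nothing of the paper is asserted) -/

/-- The zero force is admissible (smooth, divergence free, entire extension `0`): Theorem 1.2 covers the
unforced problem. [cite: Nadirashvili2026, §1 p.3] -/
theorem isAdmissibleForce_zero : IsAdmissibleForce (0 : ℝ → T3 → E3) := by
  refine ⟨fun t _ => ?_, fun t _ => ?_, ⟨fun _ _ => 0, fun T _ => ⟨1, 0, one_pos, fun t _ => ?_⟩⟩⟩
  · exact Torus.isSmooth_const (0 : E3)
  · intro x
    simp [Torus.divergence, Torus.partialDeriv, Torus.lineDeriv]
  · refine ⟨differentiableOn_const _, fun z _ => by simp, fun x => ?_⟩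
    simp

/-- Theorem 1.2 implies its unforced specialisation. [cite: Nadirashvili2026, Theorem 1.2 p.3] -/
theorem claimed₀_of_claimed (h : ClaimedTheorem) : ClaimedAnalyticity₀ :=
  fun ν hν u₀ hu₀ hdiv u hu t ht => h.1 ν hν 0 isAdmissibleForce_zero u₀ hu₀ hdiv u hu t ht

/-- `y_k(0) = 0` (p.36 «Φ(0,t) = 0» uses `y(0) = 0`). [cite: Nadirashvili2026, §5 p.35–36] -/
theorem yk_zero (k : ℝ) : yk k 0 = 0 := by
  simp [yk, Real.zero_rpow (by norm_num : (41 / 8 : ℝ) ≠ 0)]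

/-- `y_k′ = dyk k`: the derivative of the printed comparison function (p.35, used in (5.12)–(5.19)).
[cite: Nadirashvili2026, §5 p.35] -/
theorem hasDerivAt_yk (k x : ℝ) : HasDerivAt (yk k) (dyk k x) x := by
  have h1 : HasDerivAt (fun x : ℝ => k / 120 * x ^ 5) (k / 120 * (5 * x ^ 4)) x :=
    (hasDerivAt_pow 5 x).const_mul _
  have h2 : HasDerivAt (fun x : ℝ => x ^ (41 / 8 : ℝ)) ((41 / 8 : ℝ) * x ^ ((41 / 8 : ℝ) - 1)) x :=
    Real.hasDerivAt_rpow_const (Or.inr (by norm_num))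
  have h := h1.add h2
  have e : k / 120 * (5 * x ^ 4) + 41 / 8 * x ^ ((41 / 8 : ℝ) - 1) = dyk k x := by
    rw [show (41 / 8 : ℝ) - 1 = 33 / 8 by norm_num, dyk]; ring
  rw [← e]
  exact h

/-- `y_k″ = ddyk k` (p.35–36, used in (5.18), (5.23)). [cite: Nadirashvili2026, §5 p.35–36] -/
theorem hasDerivAt_dyk (k x : ℝ) : HasDerivAt (dyk k) (ddyk k x) x := by
  have h1 : HasDerivAt (fun x : ℝ => k / 24 * x ^ 4) (k / 24 * (4 * x ^ 3)) x :=
    (hasDerivAt_pow 4 x).const_mul _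
  have h2 : HasDerivAt (fun x : ℝ => 41 / 8 * x ^ (33 / 8 : ℝ))
      (41 / 8 * ((33 / 8 : ℝ) * x ^ ((33 / 8 : ℝ) - 1))) x :=
    (Real.hasDerivAt_rpow_const (Or.inr (by norm_num))).const_mul _
  have h := h1.add h2
  have e : k / 24 * (4 * x ^ 3) + 41 / 8 * ((33 / 8 : ℝ) * x ^ ((33 / 8 : ℝ) - 1)) = ddyk k x := by
    rw [show (33 / 8 : ℝ) - 1 = 25 / 8 by norm_num, ddyk]; ring
  rw [← e]
  exact h

/-- Positivity of `y′_k` on `(0,∞)` for `k ≥ 0` (p.37 «Since y″, y′ > 0»). [cite: Nadirashvili2026, §5 p.37] -/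
theorem dyk_pos {k x : ℝ} (hk : 0 ≤ k) (hx : 0 < x) : 0 < dyk k x := by
  have h1 : 0 ≤ k / 24 * x ^ 4 := by positivity
  have h2 : 0 < x ^ (33 / 8 : ℝ) := Real.rpow_pos_of_pos hx _
  unfold dyk
  linarith

/-- Positivity of `y″_k` on `(0,∞)` for `k ≥ 0` (p.37 «Since y″, y′ > 0»). [cite: Nadirashvili2026, §5 p.37] -/
theorem ddyk_pos {k x : ℝ} (hk : 0 ≤ k) (hx : 0 < x) : 0 < ddyk k x := by
  have h1 : 0 ≤ k / 6 * x ^ 3 := by positivity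
  have h2 : 0 < x ^ (25 / 8 : ℝ) := Real.rpow_pos_of_pos hx _
  unfold ddyk
  nlinarith

/-- The complex energy over the empty ball vanishes: `E(0,t) = 0` (p.36 «Φ(0,t) = 0»).
[cite: Nadirashvili2026, §5 p.36] -/
theorem cE_zero (N : ℕ) (a : T3 → E3) : cE N a 0 = 0 := by
  simp [cE, Metric.ball_zero]

/-- **The closing algebra p.37–38 [1650–1667]** «Denote S(r,y″,y′) = 1 − (b/r^{3/2})(y′)^{1/2} −
(4/r)(y′/y″) − Cr³(y′)^{1/2}/y″ … Since y″, y′ > 0, S is an increasing function of y″. Then from (5.21),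
(5.23) follows S(r₀, E″, E′) > 0»: if `y′, y″ > 0` obey the strict inequality (5.18) at `r` and
`E_r = y′`, `E_rr ≥ y″`, then `E_rr > (b/r^{3/2}) E_rr E_r^{1/2} + (4/r) E_r + C r³ E_r^{1/2}`. PROVED.
[cite: Nadirashvili2026, §5 p.37–38] -/
theorem strict_of_subsol {b C r y' y'' Er Err : ℝ} (hb : 0 ≤ b) (hC : 0 ≤ C) (hr : 0 < r)
    (hy' : 0 < y') (hy'' : 0 < y'')
    (hsub : b / r ^ (3 / 2 : ℝ) * y'' * Real.sqrt y' + 4 / r * y' + C * r ^ 3 * Real.sqrt y' < y'')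
    (h1 : Er = y') (h3 : y'' ≤ Err) :
    b / r ^ (3 / 2 : ℝ) * Err * Real.sqrt Er + 4 / r * Er + C * r ^ 3 * Real.sqrt Er < Err := by
  subst h1
  set β : ℝ := b / r ^ (3 / 2 : ℝ) * Real.sqrt Er with hβ
  set A : ℝ := 4 / r * Er + C * r ^ 3 * Real.sqrt Er with hA
  have hβ0 : 0 ≤ β := by
    have : 0 < r ^ (3 / 2 : ℝ) := Real.rpow_pos_of_pos hr _
    positivity
  have hA0 : 0 ≤ A := by positivity
  have hsub' : β * y'' + A < y'' := by
    have : b / r ^ (3 / 2 : ℝ) * y'' * Real.sqrt Er = β * y'' := by rw [hβ]; ring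
    linarith [this]
  have hone : 0 < 1 - β := by nlinarith
  have key : β * Err + A < Err := by nlinarith [mul_le_mul_of_nonneg_left h3 hone.le]
  have : b / r ^ (3 / 2 : ℝ) * Err * Real.sqrt Er = β * Err := by rw [hβ]; ring
  linarith [this]

/-- **The §5 contradiction, kernel-checked from the typed steps (pp.34–38)**: in any époque scenario the
steps of §5 yield `False` — Galerkin approximants (Step 2), the choice of `k ≥ K`, `n`, `t₂ < t₃` (the
conclusion of Step 5), the parabolic inequality (5.16) (Step 6), (5.13)/(5.19) (Step 7), (5.14) (Step 8),
(5.15) (Step 9), the subsolution property (5.18) (Step 10), the sup-argument (5.21)–(5.23) (Step 11), and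
the closing algebra (`strict_of_subsol`) against (5.17) = (5.16) with `E_t ≥ 0`. PROVED (pure logic and
the displayed algebra). [cite: Nadirashvili2026, §5 pp.34–38] -/
theorem epoque_false_of_steps (hG : Step_galerkin) (hch : ChoiceBody) (hpa : Step_parce)
    (hS1 : Step_SN1) (hS6 : Step_SN6) (hS2 : Step_SN2) (hsub : Step_subsol) (hsup : Step_sup)
    {ν : ℝ} {p : ℝ≥0∞} {u₀ : T3 → E3} {u : ℝ → T3 → E3} {t₁ : ℝ} {U : ℝ → T3 → E3}
    {P : ℝ → T3 → ℝ} (hE : EpoqueData ν p u₀ u t₁ U P) : False := by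
  have hν : 0 < ν := hE.visc
  obtain ⟨C₀, hC₀, hparce⟩ := hpa
  obtain ⟨C, hC, hparce'⟩ := hparce ν hν
  obtain ⟨N, F, W, hSch, hF0, hKE⟩ := hG ν p u₀ u t₁ U P hE
  -- the subsolution threshold for the constants (C + 1, b = C₀/ν)
  have hb : 0 < C₀ / ν := div_pos hC₀ hν
  obtain ⟨K, hKpos, hK⟩ := hsub (C + 1) (C₀ / ν) (by linarith) hb
  -- the energy bound of the scheme and the thresholds of (5.13), (5.15)
  have hB : 0 ≤ Torus.kineticEnergy u₀ := by
    unfold Torus.kineticEnergy; positivity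
  obtain ⟨k₁, hk₁⟩ := hS1 (Torus.kineticEnergy u₀) hB
  obtain ⟨k₂, hk₂⟩ := hS2
  -- choice of k ≥ K', n, t₂ < t₃
  set K' : ℝ := max (max K k₁) (max k₂ 2) + 1 with hK'
  have hK'pos : 0 < K' := by
    have : (2 : ℝ) ≤ max (max K k₁) (max k₂ 2) := le_trans (le_max_right _ _) (le_max_right _ _)
    linarith
  obtain ⟨k, hKk, n, t₂, t₃, ht₂, ht₂₃, ht₃₁, hd₂, hd₃, hmid⟩ := hch ν p u₀ u t₁ U P hE N F W hSch hF0 K' hK'pos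
  have hmax : max (max K k₁) (max k₂ 2) < k := by linarith
  have hKlt : K < k := lt_of_le_of_lt (le_trans (le_max_left _ _) (le_max_left _ _)) hmax
  have hk₁le : k₁ ≤ k := (le_trans (le_trans (le_max_right _ _) (le_max_left _ _)) hmax.le)
  have hk₂le : k₂ ≤ k := (le_trans (le_trans (le_max_left _ _) (le_max_right _ _)) hmax.le)
  have hk2 : 2 ≤ k := (le_trans (le_trans (le_max_right _ _) (le_max_right _ _)) hmax.le)
  have hkpos : 0 < k := by linarith
  -- the window δ = k^{-3/2} ∈ (0,1)
  set δ : ℝ := k ^ (-(3 / 2 : ℝ)) with hδ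
  have hδpos : 0 < δ := Real.rpow_pos_of_pos hkpos _
  have hδlt : δ < 1 := Real.rpow_lt_one_of_one_lt_of_neg (by linarith) (by norm_num)
  -- Step 6 for this approximant
  obtain ⟨⟨hcont, hdiff⟩, hineq⟩ := hparce' u₀ N F W hSch hF0 n
  -- the sup-argument (Step 11) applied to E(r,t) = cE (N n) (W n t) r on [0,δ] × [t₂,t₃]
  have hmode : ∀ t, 0 ≤ t → IsGalerkinMode (N n) (W n t) := fun t ht => hSch.isGalerkinMode n t ht
  obtain ⟨T, ⟨hT₂, hT₃⟩, r₀, ⟨hr₀, hr₀δ⟩, hE1, hE3, hE2⟩ :=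
    hsup δ t₂ t₃ (yk k) (dyk k) (ddyk k) (fun r t => cE (N n) (W n t) r) hδpos ht₂₃ (yk_zero k)
      (fun x _ => hasDerivAt_yk k x) (fun x _ => hasDerivAt_dyk k x)
      (hcont.mono (Set.prod_mono (Icc_subset_Icc le_rfl hδlt.le)
        (fun t ht => (le_trans ht₂.le ht.1 : (0 : ℝ) ≤ t))))
      ⟨Ioo 0 1 ×ˢ Ioi 0, isOpen_Ioo.prod isOpen_Ioi,
        Set.prod_mono (fun r hr => ⟨hr.1, lt_of_le_of_lt hr.2 hδlt⟩)
          (fun t ht => (lt_of_lt_of_le ht₂ ht.1 : (0 : ℝ) < t)), hdiff⟩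
      (fun t _ => cE_zero (N n) (W n t))
      (fun t ht => by
        have ht0 : 0 ≤ t := le_trans ht₂.le ht.1
        have hkd : k ≤ d5 (W n t) := by
          rcases eq_or_lt_of_le ht.1 with h | h
          · rw [← h, hd₂]
          rcases eq_or_lt_of_le ht.2 with h' | h'
          · rw [h', hd₃]; linarith
          · exact (hmid t ⟨h, h'⟩).le
        exact hk₁ k hk₁le (N n) (W n t) (hmode t ht0) (hKE n t ht0) hkd)
      (by
        obtain ⟨ε, hε, hεx⟩ := hS6 (N n) (W n t₂) k (hmode t₂ ht₂.le) hkpos hd₂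
        refine ⟨min ε δ / 2, ⟨by positivity, ?_⟩, hεx _ ⟨by positivity, ?_⟩⟩
        · have : min ε δ ≤ δ := min_le_right _ _
          linarith
        · have : min ε δ ≤ ε := min_le_left _ _
          linarith)
      (fun x hx => hk₂ k hk₂le (N n) (W n t₃) (hmode t₃ (by linarith)) (by rw [hd₃]) x hx)
  -- (5.18) at r₀ (Step 10) and the closing algebra
  have hr₀k : r₀ ∈ Ioo 0 (k ^ (-(3 / 2 : ℝ))) := ⟨hr₀, hr₀δ⟩
  have hsub₀ := hK k hKlt r₀ hr₀k
  have hy' : 0 < dyk k r₀ := dyk_pos hkpos.le hr₀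
  have hy'' : 0 < ddyk k r₀ := ddyk_pos hkpos.le hr₀
  have hstrict := strict_of_subsol hb.le (by linarith : (0 : ℝ) ≤ C + 1) hr₀ hy' hy'' hsub₀ hE1 hE3
  -- (5.16) at (r₀, T) (Step 6), with E_t(r₀,T) ≥ 0 giving (5.17)
  have hT0 : (0 : ℝ) < T := lt_trans ht₂ hT₂
  have hpar := hineq r₀ ⟨hr₀, lt_trans hr₀δ hδlt⟩ T hT0
  have hEt : 0 ≤ 4 / ν * deriv (fun s => cE (N n) (W n s) r₀) T := by
    have : 0 ≤ deriv (fun s => cE (N n) (W n s) r₀) T := hE2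
    positivity
  -- compare
  set Er : ℝ := deriv (cE (N n) (W n T)) r₀
  set Err : ℝ := iteratedDeriv 2 (cE (N n) (W n T)) r₀
  have hsq : 0 ≤ Real.sqrt Er := Real.sqrt_nonneg _
  have hcoef : C₀ / (ν * r₀ ^ (3 / 2 : ℝ)) = C₀ / ν / r₀ ^ (3 / 2 : ℝ) := by
    rw [div_div]
  have hErrpos : 0 < Err := lt_of_lt_of_le hy'' hE3
  have hextra : C * r₀ ^ 3 * Real.sqrt Er ≤ (C + 1) * r₀ ^ 3 * Real.sqrt Er := by
    have : 0 ≤ r₀ ^ 3 * Real.sqrt Er := by positivity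
    nlinarith
  have hle : Err ≤ C₀ / ν / r₀ ^ (3 / 2 : ℝ) * Err * Real.sqrt Er + 4 / r₀ * Er +
      (C + 1) * r₀ ^ 3 * Real.sqrt Er := by
    rw [← hcoef]; linarith
  exact absurd hle (not_le.mpr hstrict)

/-- **No époque from the steps**: Steps 1–11 give `NoEpoque₀` (p.38 «Therefore w is a classical
solution … in M × (0, ∞)»). PROVED (logic). [cite: Nadirashvili2026, §5 p.38] -/
theorem noEpoque₀_of_steps (hL : Step_local) (hG : Step_galerkin) (hR : Step_LerayRate)
    (hP : Step_Prop23) (hch : Step_choice) (hpa : Step_parce) (hS1 : Step_SN1) (hS6 : Step_SN6)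
    (hS2 : Step_SN2) (hsub : Step_subsol) (hsup : Step_sup) : NoEpoque₀ := by
  intro ν p u₀ u hν hp hu₀ hdiv hLH
  by_contra hno
  obtain ⟨t₁, U, P, hE⟩ := hL ν p u₀ u hν hp hu₀ hdiv hLH hno
  exact epoque_false_of_steps hG (hch ⟨hR, hP⟩) hpa hS1 hS6 hS2 hsub hsup hE

/-- **COMPOSITION** — PROVED; every numbered step consumed: the paper's logic, as typed, carries
Steps 1–12 to Theorem 1.2 at `f ≡ 0`. [cite: Nadirashvili2026, §5 pp.28–39] -/
theorem claim_of_steps (hL : Step_local) (hG : Step_galerkin) (hR : Step_LerayRate)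
    (hP : Step_Prop23) (hch : Step_choice) (hpa : Step_parce) (hS1 : Step_SN1) (hS6 : Step_SN6)
    (hS2 : Step_SN2) (hsub : Step_subsol) (hsup : Step_sup) (hglue : Step_glue) :
    ClaimedAnalyticity₀ :=
  hglue (noEpoque₀_of_steps hL hG hR hP hch hpa hS1 hS6 hS2 hsub hsup)

/-- **Clay link modulo the typed delta**: `ClayDelta` (Leray–Hopf existence + the standard local/
weak–strong bridge, not printed) and Theorem 1.2 at `f ≡ 0` give Clay (B) — via the torus form
`ClayVariants.clayPeriodic_regularityAt_iff_torus`. PROVED. [cite: FeffermanClay2006, (B) p. 2] -/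
theorem clayB_of_claimed₀_of_delta (hΔ : ClayDelta) (h : ClaimedAnalyticity₀) :
    ClayVariants.clayPeriodic.Regularity := by
  intro ν hν
  refine (ClayVariants.clayPeriodic_regularityAt_iff_torus hν).2 fun U₀ hs hd => ?_
  exact hΔ ν hν U₀ hs hd fun u hu t ht =>
    h ν hν U₀ (hs.memLp 2) (Torus.IsDivFree.isWeaklyDivFree_holds hs hd) u hu t ht

/-- **Clay link for the printed theorem**: `ClayDelta → ClaimedTheorem → Clay (B)`. PROVED.
[cite: FeffermanClay2006, (B) p. 2] -/
theorem clay_of_claimed_of_delta (hΔ : ClayDelta) (h : ClaimedTheorem) :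
    ClayVariants.clayPeriodic.Regularity :=
  clayB_of_claimed₀_of_delta hΔ (claimed₀_of_claimed h)

/-! ## F. Rev 2 (ADDITIVE; asks of referee ns-claims-ref-3 g2 03:28Z / RETYPE.md v0.1 and refuter-5 g0 03:34Z):
finer grains and recorded displays — nothing above is renamed or changed -/

/-- `deriv y_k = y′_k` as functions. [cite: Nadirashvili2026, §5 p.35] -/
theorem deriv_yk (k : ℝ) : deriv (yk k) = dyk k :=
  funext fun x => (hasDerivAt_yk k x).deriv

/-- `deriv y′_k = y″_k` as functions. [cite: Nadirashvili2026, §5 p.35–36] -/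
theorem deriv_dyk (k : ℝ) : deriv (dyk k) = ddyk k :=
  funext fun x => (hasDerivAt_dyk k x).deriv

/-- **Step 10, `deriv` spelling (refuter-5 g0's grain request)** — (5.18) p.36 with `y′_k = deriv y_k`,
`y″_k = deriv (deriv y_k)` instead of the closed forms; kernel-equivalent to `Step_subsol`
(`step_subsol_deriv_iff`). [claim: Nadirashvili2026, status: disputed] -/
def Step_subsol_deriv : Prop :=
  ∀ C b : ℝ, 0 < C → 0 < b → ∃ K : ℝ, 0 < K ∧ ∀ k : ℝ, K < k →
    ∀ x ∈ Ioo 0 (k ^ (-(3 / 2 : ℝ))),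
      b / x ^ (3 / 2 : ℝ) * deriv (deriv (yk k)) x * Real.sqrt (deriv (yk k) x) +
          4 / x * deriv (yk k) x + C * x ^ 3 * Real.sqrt (deriv (yk k) x) <
        deriv (deriv (yk k)) x

/-- The two spellings of Step 10 agree. PROVED. [cite: Nadirashvili2026, §5 (5.18) p.36] -/
theorem step_subsol_deriv_iff : Step_subsol_deriv ↔ Step_subsol := by
  simp only [Step_subsol_deriv, Step_subsol, deriv_yk, deriv_dyk]

/-- **Recorded display — (5.20) p.37 l.1–3 AS PRINTED** «Φ′(δ,t) > 0», i.e. `y′_k(δ) − E_r(δ,t) > 0`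
for `t₂ < t < t₃`, at the carrier grain (every Galerkin mode with `∂⁵E/∂r⁵(0) > k`, energy ≤ B, `k`
large). The print derives it «from inequality (5.19)», which gives the OPPOSITE sign
(`E_r(δ,t) > y′_k(δ)`); the direction the argument needs at p.37 l.18–19 («0 < r₀ < δ») is
`Φ_r(δ,t) < 0`, which is what `Step_sup` takes. Not on the composition path.
[claim: Nadirashvili2026, status: disputed] -/
def Step_520_printed : Prop :=
  ∀ B : ℝ, 0 ≤ B → ∃ k₀ : ℝ, ∀ k : ℝ, k₀ ≤ k →
    ∀ (N : ℕ) (a : T3 → E3), IsGalerkinMode N a → Torus.kineticEnergy a ≤ B → k < d5 a →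
      deriv (cE N a) (k ^ (-(3 / 2 : ℝ))) < dyk k (k ^ (-(3 / 2 : ℝ)))

/-- **Recorded — the referee's ONE charitable re-typing of (5.13), «margin form (5.13)′»** (ns-claims-ref-3
g2, RETYPE.md v0.1 §1): if `∂⁵E(0,t₀)/∂r⁵ > k + 123·k^{−3/16}` then `E_r(k^{−3/2},t₀) > y′_k(k^{−3/2})`
(from Lemma 5.5 alone: `E_r(δ) ≥ (∂⁵E(0)/∂r⁵)δ⁴/24` and `(L − k)δ⁴/24 ≥ (41/8)δ^{33/8} ⇔ L − k ≥
123 δ^{1/8} = 123 k^{−3/16}`), at the carrier grain. Not on the composition path; under it the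
hypothesis (5.19) of `Step_sup` is available only where the level exceeds `k` by the margin —
see `Step_sup_margin`. [claim: Nadirashvili2026, status: disputed] -/
def Step_513_margin : Prop :=
  ∀ (k : ℝ) (N : ℕ) (a : T3 → E3), 0 < k → IsGalerkinMode N a →
    k + 123 * k ^ (-(3 / 16 : ℝ)) < d5 a →
      dyk k (k ^ (-(3 / 2 : ℝ))) < deriv (cE N a) (k ^ (-(3 / 2 : ℝ)))

/-- **Recorded SHAPE ONLY, NOT a statement of record — Step 11 under the charitable (5.13)′ (the residual
locus p.37 l.12–19 «Let 0 ≤ r₀ ≤ δ be such that Φ(r₀,T) = φ(T). From inequality (5.20) follows 0 < r₀ < δ»)**: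
the sup-argument when the boundary sign (5.19)/(5.20) is available only at times `t` whose level
`ℓ(t) = ∂⁵E(0,t)/∂r⁵` exceeds `κ = ℓ(t₂)` by a margin `μ > 0` (ℓ continuous). Whether the time `T` produced
by «there exists T ∈ (0,τ) such that φ′(T) < 0» is such a time is what p.37 l.18–19 would need; nothing
printed places it there (ref-3 RETYPE v1 §1/§1b: residual «unfilled gap» of both charitable paths, stable
under the whole comparison family). REV 3 NOTE: AS TYPED this Prop is KERNEL-FALSE by junk instances in which
`E` carries none of the Lemma-5.5 Taylor structure and `ℓ` is not tied to `E` (ns-claims-refuter-5 g2 scratch,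
2026-08-27: `δ = 1`, `[t₂,t₃] = [0,1]`, `κ = 0`, `μ = 1`, `ℓ ≡ 0` so the guarded (5.19) is idle, `y = x²`,
`E(x,t) = t·x`, `E_rr ≡ 0 < 2 = y″`; ns-claims-ref-3 g3 REF F-pass: `y ≡ 0`, `E(r,t) = (2 − t/2)r + 4(t−1)r²`
on `[0,1]×[0,2]`, `ℓ(t) = t` — interior critical points only for `T < 0.8`, where `E_rr = 8(T−1) < 0`).
It therefore records only the SHAPE of the residue; the residue of record is the PRINT locus p.37 l.12–19
(class under charity: unfilled gap), and at the structured grain the two requirements at the produced time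
`T` — `φ(T) > 0` (level `− k < 120·δ^{1/8}`) and (5.19) at `T` (level `− k ≥ 123·δ^{1/8}` up to the
(5.9)-controlled tail) — are incompatible (ref-3 RETYPE v1 §C). `Step_sup` itself (the printed reading,
(5.19) on all of `[t₂,t₃]`) is TRUE as a calculus lemma and is the Step the composition consumes; neither
the locator nor the class of the row depends on this decl. Not on the composition path.
[claim: Nadirashvili2026, status: disputed] -/
def Step_sup_margin : Prop :=
  ∀ (δ t₂ t₃ κ μ : ℝ) (ℓ y y' y'' : ℝ → ℝ) (E : ℝ → ℝ → ℝ), 0 < δ → t₂ < t₃ → 0 < μ → y 0 = 0 →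
    ContinuousOn ℓ (Icc t₂ t₃) → ℓ t₂ = κ →
    (∀ x ∈ Icc 0 δ, HasDerivAt y (y' x) x) → (∀ x ∈ Icc 0 δ, HasDerivAt y' (y'' x) x) →
      ContinuousOn (Function.uncurry E) (Icc 0 δ ×ˢ Icc t₂ t₃) →
        (∃ O : Set (ℝ × ℝ), IsOpen O ∧ Ioc 0 δ ×ˢ Icc t₂ t₃ ⊆ O ∧
            ContDiffOn ℝ 2 (Function.uncurry E) O) →
          (∀ t ∈ Icc t₂ t₃, E 0 t = 0) →
            (∀ t ∈ Icc t₂ t₃, κ + μ ≤ ℓ t → y' δ < deriv (fun r => E r t) δ) →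
              (∃ x ∈ Ioo 0 δ, E x t₂ < y x) →
                (∀ x ∈ Ioo 0 δ, y x < E x t₃) →
                  ∃ T ∈ Ioo t₂ t₃, ∃ r₀ ∈ Ioo 0 δ,
                    deriv (fun r => E r T) r₀ = y' r₀ ∧
                      y'' r₀ ≤ iteratedDeriv 2 (fun r => E r T) r₀ ∧
                        0 ≤ deriv (fun t => E r₀ t) T

/-- **Recorded display — Lemma 5.1 (5.1) p.28 [1245–1253]** (refuter-5 g0's F3; not load-bearing): «Let
A = {0 < x < π/b, 0 < y < r}, a = {y = r} ⊂ ∂A. Let u be a harmonic function in A, smooth in Ā and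
u = 0 on ∂A ∖ a. Let r, b ≤ 1. Then ∫_A |∇u|² dxdy ≤ ∫_A |∂u/∂x|² dxdy + (1/r)∫_a u²» (functions grain:
`u : ℝ → ℝ → ℝ`, globally C² — charitable; harmonicity via second `x`- and `y`-derivatives; integrals as
iterated interval integrals). [claim: Nadirashvili2026, status: disputed] -/
def Step_L51 : Prop :=
  ∀ (b r : ℝ) (u : ℝ → ℝ → ℝ), 0 < b → b ≤ 1 → 0 < r → r ≤ 1 →
    ContDiff ℝ 2 (Function.uncurry u) →
      (∀ x ∈ Ioo 0 (Real.pi / b), ∀ y ∈ Ioo 0 r,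
          iteratedDeriv 2 (fun s => u s y) x + iteratedDeriv 2 (u x) y = 0) →
        (∀ x ∈ Icc 0 (Real.pi / b), u x 0 = 0) →
          (∀ y ∈ Icc 0 r, u 0 y = 0 ∧ u (Real.pi / b) y = 0) →
            ∫ x in (0 : ℝ)..(Real.pi / b), ∫ y in (0 : ℝ)..r,
                (deriv (fun s => u s y) x ^ 2 + deriv (u x) y ^ 2) ≤
              (∫ x in (0 : ℝ)..(Real.pi / b), ∫ y in (0 : ℝ)..r, deriv (fun s => u s y) x ^ 2) +
                1 / r * ∫ x in (0 : ℝ)..(Real.pi / b), u x r ^ 2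

/-- `Step_sup_margin` (weaker hypotheses, same conclusion) implies Step 11: granting (5.19) on all of
`[t₂,t₃]` (the printed reading) makes the margin condition idle. PROVED (logic); since `Step_sup_margin` is
kernel-false as typed (rev 3 note in its docstring) this implication carries no content — kept for importers.
[cite: Nadirashvili2026, §5 p.36–37] -/
theorem step_sup_of_margin (h : Step_sup_margin) : Step_sup := by
  intro δ t₂ t₃ y y' y'' E hδ ht hy0 hy hy' hcont hO h0 h1 h2 h3
  exact h δ t₂ t₃ 0 1 (fun t => t - t₂) y y' y'' E hδ ht one_pos hy0
    (continuousOn_id.sub continuousOn_const) (sub_self t₂) hy hy' hcont hO h0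
    (fun t ht _ => h1 t ht) h2 h3

/-! ## §G Kernel discharge of a recorded input (append-only; ns-claims-typist-8 g4, CARD custodian, D-0026 idle pass) -/

/-- **(5.12) p.35 is TRUE — kernel discharge of the recorded input `Step_SN27`.** For `k ≥ 6` and
`0 < x < k^{−3/2}` (so `x < 1` and `k·x^{2/3} < 1`): `y′_k(x) = (k/24)x⁴ + (41/8)x^{33/8} ≤
(k/24 + 41/8)x⁴ = (k/24 + 41/8)·x^{2/3}·x^{10/3} < (1/24 + 41/(8k))·x^{10/3} ≤ (43/48)·x^{10/3} <
(x^{5/3})²`, hence `√y′_k(x) < x^{5/3}` and `x^{−3/2}√y′_k(x) < x^{−3/2}·x^{5/3} = x^{1/6}` (the typist's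
«≈ 0.204 + o(1) < 1»: `√(1/24) ≈ 0.204`). [cite: Nadirashvili2026, (5.12) p.35] -/
theorem step_SN27_holds : Step_SN27 := by
  refine ⟨6, fun k hk x hx => ?_⟩
  obtain ⟨hx0, hxk⟩ := hx
  have hk0 : 0 < k := by linarith
  -- `x < k^{-3/2} ≤ 1`
  have hk32 : k ^ (-(3 / 2 : ℝ)) ≤ 1 :=
    Real.rpow_le_one_of_one_le_of_nonpos (by linarith) (by norm_num)
  have hx1 : x < 1 := lt_of_lt_of_le hxk hk32
  -- `x^{2/3} < k^{-1}`
  have h23 : x ^ (2 / 3 : ℝ) < k⁻¹ := by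
    have h1 : x ^ (2 / 3 : ℝ) < (k ^ (-(3 / 2 : ℝ))) ^ (2 / 3 : ℝ) :=
      Real.rpow_lt_rpow hx0.le hxk (by norm_num)
    have h2 : (k ^ (-(3 / 2 : ℝ))) ^ (2 / 3 : ℝ) = k⁻¹ := by
      rw [← Real.rpow_mul hk0.le]
      norm_num
      exact Real.rpow_neg_one k
    rwa [h2] at h1
  -- the two monomials against `x^{10/3}`
  have hx4 : x ^ 4 = x ^ (2 / 3 : ℝ) * x ^ (10 / 3 : ℝ) := by
    rw [← Real.rpow_add hx0]
    norm_num
  have hx338 : x ^ (33 / 8 : ℝ) ≤ x ^ 4 := by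
    have h : x ^ (33 / 8 : ℝ) ≤ x ^ (4 : ℝ) :=
      Real.rpow_le_rpow_of_exponent_ge hx0 hx1.le (by norm_num)
    rwa [show (4 : ℝ) = ((4 : ℕ) : ℝ) by norm_num, Real.rpow_natCast] at h
  have hx103 : 0 < x ^ (10 / 3 : ℝ) := Real.rpow_pos_of_pos hx0 _
  have hx23pos : 0 < x ^ (2 / 3 : ℝ) := Real.rpow_pos_of_pos hx0 _
  -- `y'_k(x) < (43/48) x^{10/3}`
  have hd : dyk k x < 43 / 48 * x ^ (10 / 3 : ℝ) := by
    have h1 : dyk k x ≤ (k / 24 + 41 / 8) * x ^ 4 := by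
      unfold dyk
      nlinarith [hx338, hk0]
    have h2 : (k / 24 + 41 / 8) * x ^ 4 < (1 / 24 + 41 / (8 * k)) * x ^ (10 / 3 : ℝ) := by
      rw [hx4]
      have h3 : (k / 24 + 41 / 8) * x ^ (2 / 3 : ℝ) < 1 / 24 + 41 / (8 * k) := by
        have h4 : (k / 24 + 41 / 8) * x ^ (2 / 3 : ℝ) < (k / 24 + 41 / 8) * k⁻¹ :=
          mul_lt_mul_of_pos_left h23 (by positivity)
        have h5 : (k / 24 + 41 / 8) * k⁻¹ = 1 / 24 + 41 / (8 * k) := by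
          field_simp
        linarith [h5 ▸ h4]
      calc (k / 24 + 41 / 8) * (x ^ (2 / 3 : ℝ) * x ^ (10 / 3 : ℝ))
          = ((k / 24 + 41 / 8) * x ^ (2 / 3 : ℝ)) * x ^ (10 / 3 : ℝ) := by ring
        _ < (1 / 24 + 41 / (8 * k)) * x ^ (10 / 3 : ℝ) := mul_lt_mul_of_pos_right h3 hx103
    have h6 : 1 / 24 + 41 / (8 * k) ≤ 43 / 48 := by
      have : 41 / (8 * k) ≤ 41 / 48 := by
        apply div_le_div_of_nonneg_left (by norm_num) (by norm_num) (by linarith)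
      linarith
    calc dyk k x ≤ (k / 24 + 41 / 8) * x ^ 4 := h1
      _ < (1 / 24 + 41 / (8 * k)) * x ^ (10 / 3 : ℝ) := h2
      _ ≤ 43 / 48 * x ^ (10 / 3 : ℝ) := mul_le_mul_of_nonneg_right h6 hx103.le
  -- `√(y'_k) < x^{5/3}`
  have hx53 : 0 < x ^ (5 / 3 : ℝ) := Real.rpow_pos_of_pos hx0 _
  have hsq : (x ^ (5 / 3 : ℝ)) ^ 2 = x ^ (10 / 3 : ℝ) := by
    rw [← Real.rpow_natCast, ← Real.rpow_mul hx0.le]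
    norm_num
  have hsqrt : Real.sqrt (dyk k x) < x ^ (5 / 3 : ℝ) := by
    rw [Real.sqrt_lt' hx53, hsq]
    linarith
  -- conclude
  have hx32 : 0 < x ^ (-(3 / 2 : ℝ)) := Real.rpow_pos_of_pos hx0 _
  calc x ^ (-(3 / 2 : ℝ)) * Real.sqrt (dyk k x)
      < x ^ (-(3 / 2 : ℝ)) * x ^ (5 / 3 : ℝ) := mul_lt_mul_of_pos_left hsqrt hx32
    _ = x ^ (1 / 6 : ℝ) := by
        rw [← Real.rpow_add hx0]
        norm_num

/-- `Step_SN27` — `_holds` alias of `step_SN27_holds` above under the fact's exact name (appended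
2026-08-28, D-0026 bookkeeping: the proof term is the existing theorem of this file; no statement,
definition or attribute is edited; no new named fact; the ledger's debt table listed the fact
unproved). [cite: Nadirashvili2026, (5.12) p.35] -/
theorem _root_.Literature.Claims.NS.Nadirashvili2026.Step_SN27_holds : Step_SN27 :=
  _root_.Literature.Claims.NS.Nadirashvili2026.step_SN27_holds


/-! ## G. In-file discharge of Step 2 (`Step_galerkin`) — D-0026 debt pass (ns-claims-typist-3 g5,
2026-08-27; APPEND-ONLY: no statement, locator, class or token of row C129 #116 is touched) -/

/-- **Step 2 holds** (§2 p.8 (2.8)–(2.9) with (2.6)–(2.7), used p.34 [1512–1513]; implicit/standard):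
in an époque scenario the datum `u₀ ∈ Lᵖ(𝕋³) ⊂ L²(𝕋³)` (`p > 3`, finite measure) is weakly
divergence free and `ν > 0`, so the tree's UNFORCED Hopf–Galerkin construction
`Literature.Analysis.FluidPDE.exists_isHopfGalerkinScheme_unforced_energy_le`
(`NSHopfGalerkinUnforced`; Robinson–Rodrigo–Sadowski 2016, Thm. 4.4 Steps 1–2 at `f = 0`, with
(4.8) «‖u_n(t)‖ ≤ ‖u₀‖» from the Galerkin energy identity and Lemma 4.1 `‖P_n u‖ ≤ ‖u‖`) supplies a
scheme with `F n = 0` literally and every slice energy-bounded by the datum — exactly the typed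
conclusion. The remaining fields of `EpoqueData` (the époque itself) are not used.
[cite: Nadirashvili2026, §2 p.8 (2.8)–(2.9)] [cite: RobinsonRodrigoSadowski2016, Thm. 4.4 (4.8) p.74] -/
theorem step_galerkin_holds : Step_galerkin := by
  intro ν p u₀ u t₁ U P hE
  have hu₀2 : MemLp u₀ 2 volume :=
    hE.datum.mono_exponent (le_of_lt (lt_trans (by norm_num) hE.exponent))
  exact exists_isHopfGalerkinScheme_unforced_energy_le ν hE.visc u₀ hu₀2 hE.divFree

/-- `Step_galerkin` — `_holds` alias of `step_galerkin_holds` above under the fact's exact name (appended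
2026-08-28, D-0026 bookkeeping: the proof term is the existing theorem of this file; no statement,
definition or attribute is edited; no new named fact; the ledger's debt table listed the fact
unproved). [cite: RobinsonRodrigoSadowski2016, Thm. 4.4 (4.8) p.74] -/
theorem _root_.Literature.Claims.NS.Nadirashvili2026.Step_galerkin_holds : Step_galerkin :=
  _root_.Literature.Claims.NS.Nadirashvili2026.step_galerkin_holds

end

end Literature.Claims.NS.Nadirashvili2026

-- WHAT THIS IS NOT: not a claim about NS regularity or blow-up; not a claim about any author beyond the typed locator.
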